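import Summits.BirchSwinnertonDyer.BirchSwinnertonDyer.Theorems.ManinLocalTwoThreeEulerRemaindersSeventyTwo
import HarnessLib

/-!
# Level 144 (class `144a`), the `q`-toolkit: `E₆, E₁₂, E₁₈, E₂₄` and `E₂(δτ)` (`δ ∈ {6, 12, 18, 24, 36, 72}`) to `o(q²⁵)`

Cell bsd-f2-manin, route `ManinLocalTwoThree` (cruxes C2 `ManinOddAtFour` stmt-22967 / C3 `ManinPrimeToThreeAtNine` stmt-22968;
`144 = 2⁴·3²` lies in BOTH domains, genus `13`, two newforms `144a`, `144b`), prover seat p3 gen 24.  The E₂ road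
(`EtaLogDerivativeForms`) for the class `144a` (`144a1 = [0, 0, 0, 0, −1] : y² = x³ − 1`): `x = 𝓧 = η₆η₂₄η₃₆⁶/(η₁₂²η₁₈³η₇₂³)`
(`Γ₀(72)`-invariant), `y = −𝓨`, `𝓨 = η₆²η₂₄²η₃₆²/(η₁₂²η₁₈²η₇₂²)`, and the newform `φ₁₄₄ₐ = η₁₂¹²/(η₆η₂₄)⁴` is itself an `η`-quotient
(Martin–Ono), so that `A = φ𝓨/𝓧 = η₁₂¹²η₁₈η₇₂/(η₆³η₂₄³η₃₆⁴)` and `C = φ𝓧²/𝓨 = η₁₂¹⁰η₃₆¹⁰/(η₆η₁₈η₂₄η₇₂)⁴` are SINGLE holomorphic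
`η`-quotients of weight `2` on `Γ₀(72)`: (I2a) `x′ = −2πiφ·2𝓨` ⟺ **`G_𝓧 + 48A = 0`** and (I2b) `𝓨′ = −2πiφ·3x²` ⟺ **`G_𝓨 + 72C = 0`**,
TWO-TERM linear relations in `M₂(Γ₀(72))` (Sturm: `⌊2·144/12⌋ + 1 = 25` coefficients), `G_𝓧 = 6E₂(6τ) − 24E₂(12τ) − 54E₂(18τ)
+ 24E₂(24τ) + 216E₂(36τ) − 216E₂(72τ)`, `G_𝓨 = 12E₂(6τ) − 24E₂(12τ) − 36E₂(18τ) + 48E₂(24τ) + 72E₂(36τ) − 144E₂(72τ)`.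
This file supplies the `q`-expansions to `o(q²⁵)` (`E_δ = eulerFn δ`; `E₃₆, E₇₂ = 1 + o(q²⁵)` are `EulerRemainders.tendsto_eulerFn`).
Pure `q`-series bookkeeping. Nothing here proves C2, C3, Manin's conjecture or BSD; the newform PINNING at `144` (13-dimensional, two newforms) and the class `144b` are NOT treated here. [cite: Zagier2008, §2.3] [cite: Ligozat1975, Ch. 3] [cite: MartinOno1997, Thm. 2]
-/

set_option autoImplicit false
-- lint-debt: the directory name repeats the summit name (sibling precedent `ManinLocalTwoThreeEulerRemaindersSeventyTwo.lean`)
set_option linter.dupNamespace false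

noncomputable section

open Complex Filter Topology Set Asymptotics Polynomial EisensteinSeries
open UpperHalfPlane hiding I
open scoped Real Topology Manifold MatrixGroups ModularForm
open ModularForm CongruenceSubgroup
open Literature.NumberTheory.ModularForms
open Literature.NumberTheory.EllipticCurves Literature.NumberTheory.EllipticCurves.ModularForms

namespace Summit.BirchSwinnertonDyer.BirchSwinnertonDyer.Theorems.ManinLocalTwoThree.EulerRemaindersOneFortyFour

open QRemainder EulerRemainders EtaLogDerivativeForms

/-- The `q`-coefficients `n ≤ 25` of `E6`. [folklore] -/
theorem coeff_formalEulerScaled_six_le (n : ℕ) (hn : n ≤ 25) :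
    PowerSeries.coeff n (formalEulerScaled 6) = if n = 0 then 1 else if n = 6 then -1 else if n = 12 then -1 else 0 := by
  have h := EulerRemaindersTwenty.coeff_formalEulerPow_one_le_six
  interval_cases n <;> simp +decide [coeff_formalEulerScaled, h]

/-- **`E6 = 1 - q ^ 6 - q ^ 12 + o(q²⁵)`.** [folklore] -/
theorem tendsto_eulerFn_six :
    Tendsto (fun τ : ℍ ↦ (eulerFn 6 τ - (1 - X ^ 6 - X ^ 12 : ℂ[X]).eval (Function.Periodic.qParam 1 (τ : ℂ))) / Function.Periodic.qParam 1 (τ : ℂ) ^ 25) atImInfty (𝓝 0) := by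
  refine congr_poly ?_ (tendsto_of_hasSum (periodic_eulerFn 6) (mdifferentiable_eulerFn 6)
    (isBoundedAtImInfty_eulerFn (by norm_num)) (hasSum_eulerFn (by norm_num)) 25)
  have h := coeff_formalEulerScaled_six_le
  simp only [Finset.sum_range_succ, Finset.sum_range_zero, h 0 (by norm_num), h 1 (by norm_num), h 2 (by norm_num), h 3 (by norm_num), h 4 (by norm_num), h 5 (by norm_num), h 6 (by norm_num), h 7 (by norm_num), h 8 (by norm_num), h 9 (by norm_num), h 10 (by norm_num), h 11 (by norm_num), h 12 (by norm_num), h 13 (by norm_num), h 14 (by norm_num), h 15 (by norm_num), h 16 (by norm_num), h 17 (by norm_num), h 18 (by norm_num), h 19 (by norm_num), h 20 (by norm_num), h 21 (by norm_num), h 22 (by norm_num), h 23 (by norm_num), h 24 (by norm_num), h 25 (by norm_num)]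
  norm_num
  ring

/-- The `q`-coefficients `n ≤ 25` of `E12`. [folklore] -/
theorem coeff_formalEulerScaled_twelve_le (n : ℕ) (hn : n ≤ 25) :
    PowerSeries.coeff n (formalEulerScaled 12) = if n = 0 then 1 else if n = 12 then -1 else if n = 24 then -1 else 0 := by
  have h := EulerRemaindersTwenty.coeff_formalEulerPow_one_le_six
  interval_cases n <;> simp +decide [coeff_formalEulerScaled, h]

/-- **`E12 = 1 - q ^ 12 - q ^ 24 + o(q²⁵)`.** [folklore] -/
theorem tendsto_eulerFn_twelve :
    Tendsto (fun τ : ℍ ↦ (eulerFn 12 τ - (1 - X ^ 12 - X ^ 24 : ℂ[X]).eval (Function.Periodic.qParam 1 (τ : ℂ))) / Function.Periodic.qParam 1 (τ : ℂ) ^ 25) atImInfty (𝓝 0) := by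
  refine congr_poly ?_ (tendsto_of_hasSum (periodic_eulerFn 12) (mdifferentiable_eulerFn 12)
    (isBoundedAtImInfty_eulerFn (by norm_num)) (hasSum_eulerFn (by norm_num)) 25)
  have h := coeff_formalEulerScaled_twelve_le
  simp only [Finset.sum_range_succ, Finset.sum_range_zero, h 0 (by norm_num), h 1 (by norm_num), h 2 (by norm_num), h 3 (by norm_num), h 4 (by norm_num), h 5 (by norm_num), h 6 (by norm_num), h 7 (by norm_num), h 8 (by norm_num), h 9 (by norm_num), h 10 (by norm_num), h 11 (by norm_num), h 12 (by norm_num), h 13 (by norm_num), h 14 (by norm_num), h 15 (by norm_num), h 16 (by norm_num), h 17 (by norm_num), h 18 (by norm_num), h 19 (by norm_num), h 20 (by norm_num), h 21 (by norm_num), h 22 (by norm_num), h 23 (by norm_num), h 24 (by norm_num), h 25 (by norm_num)]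
  norm_num
  ring

/-- The `q`-coefficients `n ≤ 25` of `E18`. [folklore] -/
theorem coeff_formalEulerScaled_eighteen_le (n : ℕ) (hn : n ≤ 25) :
    PowerSeries.coeff n (formalEulerScaled 18) = if n = 0 then 1 else if n = 18 then -1 else 0 := by
  have h := EulerRemaindersTwenty.coeff_formalEulerPow_one_le_six
  interval_cases n <;> simp +decide [coeff_formalEulerScaled, h]

/-- **`E18 = 1 - q ^ 18 + o(q²⁵)`.** [folklore] -/
theorem tendsto_eulerFn_eighteen :
    Tendsto (fun τ : ℍ ↦ (eulerFn 18 τ - (1 - X ^ 18 : ℂ[X]).eval (Function.Periodic.qParam 1 (τ : ℂ))) / Function.Periodic.qParam 1 (τ : ℂ) ^ 25) atImInfty (𝓝 0) := by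
  refine congr_poly ?_ (tendsto_of_hasSum (periodic_eulerFn 18) (mdifferentiable_eulerFn 18)
    (isBoundedAtImInfty_eulerFn (by norm_num)) (hasSum_eulerFn (by norm_num)) 25)
  have h := coeff_formalEulerScaled_eighteen_le
  simp only [Finset.sum_range_succ, Finset.sum_range_zero, h 0 (by norm_num), h 1 (by norm_num), h 2 (by norm_num), h 3 (by norm_num), h 4 (by norm_num), h 5 (by norm_num), h 6 (by norm_num), h 7 (by norm_num), h 8 (by norm_num), h 9 (by norm_num), h 10 (by norm_num), h 11 (by norm_num), h 12 (by norm_num), h 13 (by norm_num), h 14 (by norm_num), h 15 (by norm_num), h 16 (by norm_num), h 17 (by norm_num), h 18 (by norm_num), h 19 (by norm_num), h 20 (by norm_num), h 21 (by norm_num), h 22 (by norm_num), h 23 (by norm_num), h 24 (by norm_num), h 25 (by norm_num)]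
  norm_num
  ring

/-- The `q`-coefficients `n ≤ 25` of `E24`. [folklore] -/
theorem coeff_formalEulerScaled_twentyFour_le (n : ℕ) (hn : n ≤ 25) :
    PowerSeries.coeff n (formalEulerScaled 24) = if n = 0 then 1 else if n = 24 then -1 else 0 := by
  have h := EulerRemaindersTwenty.coeff_formalEulerPow_one_le_six
  interval_cases n <;> simp +decide [coeff_formalEulerScaled, h]

/-- **`E24 = 1 - q ^ 24 + o(q²⁵)`.** [folklore] -/
theorem tendsto_eulerFn_twentyFour :
    Tendsto (fun τ : ℍ ↦ (eulerFn 24 τ - (1 - X ^ 24 : ℂ[X]).eval (Function.Periodic.qParam 1 (τ : ℂ))) / Function.Periodic.qParam 1 (τ : ℂ) ^ 25) atImInfty (𝓝 0) := by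
  refine congr_poly ?_ (tendsto_of_hasSum (periodic_eulerFn 24) (mdifferentiable_eulerFn 24)
    (isBoundedAtImInfty_eulerFn (by norm_num)) (hasSum_eulerFn (by norm_num)) 25)
  have h := coeff_formalEulerScaled_twentyFour_le
  simp only [Finset.sum_range_succ, Finset.sum_range_zero, h 0 (by norm_num), h 1 (by norm_num), h 2 (by norm_num), h 3 (by norm_num), h 4 (by norm_num), h 5 (by norm_num), h 6 (by norm_num), h 7 (by norm_num), h 8 (by norm_num), h 9 (by norm_num), h 10 (by norm_num), h 11 (by norm_num), h 12 (by norm_num), h 13 (by norm_num), h 14 (by norm_num), h 15 (by norm_num), h 16 (by norm_num), h 17 (by norm_num), h 18 (by norm_num), h 19 (by norm_num), h 20 (by norm_num), h 21 (by norm_num), h 22 (by norm_num), h 23 (by norm_num), h 24 (by norm_num), h 25 (by norm_num)]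
  norm_num
  ring

/-- **`E₂(6τ) = 1 - 24 * q ^ 6 - 72 * q ^ 12 - 96 * q ^ 18 - 168 * q ^ 24 + o(q²⁵)`.** [cite: Zagier2008, §2.3] -/
theorem tendsto_E2_six :
    Tendsto (fun τ : ℍ ↦ (E2 (sixMulPt 6 τ) - (1 - 24 * X ^ 6 - 72 * X ^ 12 - 96 * X ^ 18 - 168 * X ^ 24 : ℂ[X]).eval (Function.Periodic.qParam 1 (τ : ℂ))) / Function.Periodic.qParam 1 (τ : ℂ) ^ 25) atImInfty (𝓝 0) := by
  refine congr_poly ?_ (tendsto_E2_sixMulPt (by norm_num : 0 < 6) 25)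
  obtain ⟨s1, s2, s3, s4, s5, s6⟩ := EulerRemaindersSeventyTwo.sigma_one_le_six
  simp only [Finset.sum_range_succ, Finset.sum_range_zero, e2NatMulCoeff_eq _ _ (by norm_num : 0 < 6)]
  norm_num [s1, s2, s3, s4, s5, s6]
  simp only [map_ofNat]
  ring

/-- **`E₂(12τ) = 1 - 24 * q ^ 12 - 72 * q ^ 24 + o(q²⁵)`.** [cite: Zagier2008, §2.3] -/
theorem tendsto_E2_twelve :
    Tendsto (fun τ : ℍ ↦ (E2 (sixMulPt 12 τ) - (1 - 24 * X ^ 12 - 72 * X ^ 24 : ℂ[X]).eval (Function.Periodic.qParam 1 (τ : ℂ))) / Function.Periodic.qParam 1 (τ : ℂ) ^ 25) atImInfty (𝓝 0) := by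
  refine congr_poly ?_ (tendsto_E2_sixMulPt (by norm_num : 0 < 12) 25)
  obtain ⟨s1, s2, s3, s4, s5, s6⟩ := EulerRemaindersSeventyTwo.sigma_one_le_six
  simp only [Finset.sum_range_succ, Finset.sum_range_zero, e2NatMulCoeff_eq _ _ (by norm_num : 0 < 12)]
  norm_num [s1, s2, s3, s4, s5, s6]
  simp only [map_ofNat]
  ring

/-- **`E₂(18τ) = 1 - 24 * q ^ 18 + o(q²⁵)`.** [cite: Zagier2008, §2.3] -/
theorem tendsto_E2_eighteen :
    Tendsto (fun τ : ℍ ↦ (E2 (sixMulPt 18 τ) - (1 - 24 * X ^ 18 : ℂ[X]).eval (Function.Periodic.qParam 1 (τ : ℂ))) / Function.Periodic.qParam 1 (τ : ℂ) ^ 25) atImInfty (𝓝 0) := by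
  refine congr_poly ?_ (tendsto_E2_sixMulPt (by norm_num : 0 < 18) 25)
  obtain ⟨s1, s2, s3, s4, s5, s6⟩ := EulerRemaindersSeventyTwo.sigma_one_le_six
  simp only [Finset.sum_range_succ, Finset.sum_range_zero, e2NatMulCoeff_eq _ _ (by norm_num : 0 < 18)]
  norm_num [s1, s2, s3, s4, s5, s6]
  simp only [map_ofNat]
  ring

/-- **`E₂(24τ) = 1 - 24 * q ^ 24 + o(q²⁵)`.** [cite: Zagier2008, §2.3] -/
theorem tendsto_E2_twentyFour :
    Tendsto (fun τ : ℍ ↦ (E2 (sixMulPt 24 τ) - (1 - 24 * X ^ 24 : ℂ[X]).eval (Function.Periodic.qParam 1 (τ : ℂ))) / Function.Periodic.qParam 1 (τ : ℂ) ^ 25) atImInfty (𝓝 0) := by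
  refine congr_poly ?_ (tendsto_E2_sixMulPt (by norm_num : 0 < 24) 25)
  obtain ⟨s1, s2, s3, s4, s5, s6⟩ := EulerRemaindersSeventyTwo.sigma_one_le_six
  simp only [Finset.sum_range_succ, Finset.sum_range_zero, e2NatMulCoeff_eq _ _ (by norm_num : 0 < 24)]
  norm_num [s1, s2, s3, s4, s5, s6]
  simp only [map_ofNat]
  ring

/-- **`E₂(36τ) = 1 + o(q²⁵)`.** [cite: Zagier2008, §2.3] -/
theorem tendsto_E2_thirtySix :
    Tendsto (fun τ : ℍ ↦ (E2 (sixMulPt 36 τ) - (1 : ℂ[X]).eval (Function.Periodic.qParam 1 (τ : ℂ))) / Function.Periodic.qParam 1 (τ : ℂ) ^ 25) atImInfty (𝓝 0) := by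
  refine congr_poly ?_ (tendsto_E2_sixMulPt (by norm_num : 0 < 36) 25)
  simp only [Finset.sum_range_succ, Finset.sum_range_zero, e2NatMulCoeff_eq _ _ (by norm_num : 0 < 36)]
  norm_num

/-- **`E₂(72τ) = 1 + o(q²⁵)`.** [cite: Zagier2008, §2.3] -/
theorem tendsto_E2_seventyTwo :
    Tendsto (fun τ : ℍ ↦ (E2 (sixMulPt 72 τ) - (1 : ℂ[X]).eval (Function.Periodic.qParam 1 (τ : ℂ))) / Function.Periodic.qParam 1 (τ : ℂ) ^ 25) atImInfty (𝓝 0) := by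
  refine congr_poly ?_ (tendsto_E2_sixMulPt (by norm_num : 0 < 72) 25)
  simp only [Finset.sum_range_succ, Finset.sum_range_zero, e2NatMulCoeff_eq _ _ (by norm_num : 0 < 72)]
  norm_num

end Summit.BirchSwinnertonDyer.BirchSwinnertonDyer.Theorems.ManinLocalTwoThree.EulerRemaindersOneFortyFour

end
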